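import Summits.QuantumFields.YangMills.Theorems.LuscherReductionTwistedTraceScalingLevelFloor
import Summits.QuantumFields.YangMills.Theorems.LuscherReductionTwistedTraceScalingCoarseUpperOfHOD
import Summits.QuantumFields.YangMills.Theorems.LuscherReductionRunningReductionBOHandover
import HarnessLib

/-!
# ★★★ COARSE-LOWER(L), UNCONDITIONAL for every lattice size `L ≥ 2` — and the pair COARSE-UPPER(L) ∧ COARSE-LOWER(L) of S-BASE
# (lane A of S-BASE, crux `TwistedTraceScaling` stmt-QuantumFields-20203, line «twolattice», stub `stub_fixedLatticeTraceLaw`; lead g23; `HANDOFF-g23.md`)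

The one-line composition, in the theses cone (it uses crux ONE ✓`oneSiteLevels_proof` and the handover ✓`BOHandover.coarseLowerAt_of_boLower`, pattern of ✓`Base.coarseLower_one`):
* ★★★ `coarseLower (hL2 : 2 ≤ L)` — **COARSE-LOWER(L)**, VERBATIM the hypothesis `hLow` of ✓`Base.fixedLatticeTraceLaw_of_coarse L`: for every `k`, `ε > 0`, deep in the femto window,
  `e^{−(Δ_k+ε)·Λ(β,L)/L}·λ₀(β, L) ≤ λ_k(β, L)` — from ✓`boLower_record` (`…LevelFloor`: the level-`k` floor `e^{−ελ_b}σμ_k ≤ λ_k` and the sup bound `λ₀ ≤ e^{ελ_b}σμ₀` in the common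
  currency `σ = recordSigma L β` of the C4-CORE record);
* ★★★ `coarseUpper_and_coarseLower (hL2 : 2 ≤ L)` — the conjunction with ✓`coarseUpper` (`…CoarseUpperOfHOD`): the hypotheses `hUp ∧ hLow` of ✓`Base.fixedLatticeTraceLaw_of_coarse L`.
HONEST FRAMING: fixed lattice size `L ≥ 2`, deep in the femto window; S-BASE at `L ≥ 2` still needs its THIRD input (the window floor W(L) ∕ COARSE-TAIL(L), OPEN); `stub_cmpTwoLoop`
and the crux `TwistedTraceScaling` stay OPEN; CONDITIONAL route R2b1 (Lüscher two-lattice reduction); not infinite volume, not a mass gap, not Clay.  No named facts, no `sorry`.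
-/

set_option autoImplicit false

noncomputable section

open MeasureTheory Filter Topology Real
open scoped BigOperators
open Literature.MathematicalPhysics.QuantumFieldTheory
open Literature.MathematicalPhysics.QuantumLattice

namespace Summit.QuantumFields.YangMills.Theorems.FemtoTransferGap.TwoLattice.ConstTube

open Summit.QuantumFields.YangMills.Theorems.FemtoTransferGap

variable {L : ℕ} [NeZero L]

/-- ★★★ **COARSE-LOWER(L), UNCONDITIONAL for every `L ≥ 2`** — verbatim the hypothesis `hLow` of ✓`Base.fixedLatticeTraceLaw_of_coarse L`: for every `k` and `ε > 0`, deep in the femto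
window, `e^{−(Δ_k+ε)·Λ(β,L)/L}·λ₀(β, L) ≤ λ_k(β, L)`.  (`BO_lower(L)` ✓`boLower_record` + crux ONE through ✓`BOHandover.coarseLowerAt_of_boLower`.) [cite: Luscher1983, §3]
[cite: LuscherMunster1984, §2] -/
theorem coarseLower (hL2 : 2 ≤ L) :
    ∀ k : ℕ, ∀ ε : ℝ, 0 < ε → ∃ lam0 : ℝ, 0 < lam0 ∧ ∀ lam : ℝ, 0 < lam → lam ≤ lam0 →
      ∀ β : ℝ, InFemtoWindow lam β L →
        Real.exp (-((levelGap k + ε) * luscherLambda β L) / L) * levelValue su2Rep L β 0 ≤ levelValue su2Rep L β k :=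
  BOHandover.coarseLowerAt_of_boLower L (boLower_record hL2) oneSiteLevels_proof

/-- ★★★ **COARSE-UPPER(L) ∧ COARSE-LOWER(L)** for every `L ≥ 2`: the hypotheses `hUp` and `hLow` of ✓`Base.fixedLatticeTraceLaw_of_coarse L` (two of the three inputs of S-BASE).
[cite: Luscher1983, §3] [cite: LuscherMunster1984, §2] -/
theorem coarseUpper_and_coarseLower (hL2 : 2 ≤ L) :
    (∀ k : ℕ, ∀ d : ℝ, d < levelGap k → ∃ lam0 : ℝ, 0 < lam0 ∧ ∀ lam : ℝ, 0 < lam → lam ≤ lam0 →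
      ∀ β : ℝ, InFemtoWindow lam β L →
        levelValue su2Rep L β k ≤ Real.exp (-(d * luscherLambda β L) / L) * levelValue su2Rep L β 0) ∧
    (∀ k : ℕ, ∀ ε : ℝ, 0 < ε → ∃ lam0 : ℝ, 0 < lam0 ∧ ∀ lam : ℝ, 0 < lam → lam ≤ lam0 →
      ∀ β : ℝ, InFemtoWindow lam β L →
        Real.exp (-((levelGap k + ε) * luscherLambda β L) / L) * levelValue su2Rep L β 0 ≤ levelValue su2Rep L β k) :=
  ⟨coarseUpper hL2, coarseLower hL2⟩

end Summit.QuantumFields.YangMills.Theorems.FemtoTransferGap.TwoLattice.ConstTube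

end
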